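import Mathlib
import HarnessLib
import HarnessLib.Audit
import Summits.AtomisticToContinuum.Statement
import Literature.MathematicalPhysics.QuantumManyBody.PeriodicBoseGas
import Summits.AtomisticToContinuum.BoseEinsteinCondensation.Theorems.BECFisherTransferPeriodicOccupationStability
import HarnessLib.Audit.Status.Attr

/-!
Route: BECRiccatiGhostPlasma

# Route BECRiccatiGhostPlasma — ghost plasma in first-moment form — beyond-pair ghost work bounded
plus tagged-charge screening gives torus ODLRO

It suffices to show X = PalmAffinityBound (TORUS, uniform-in-separation ODLRO of a nonnegative
near-ground state; X is
item stmt-AtomisticToContinuum-9157, crux of the sibling route BECRieszShadow): for every repulsive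
finite-range v, all
small ρ, some C, all large N = n+1 and EVERY δ > 0 there is a nonnegative periodic δ-near-minimiser
Ψ (L = (N/ρ)^(1/3))
with ∫Ψ(x,Y)² dY ≤ e^C ∫Ψ(x,Y)Ψ(y,Y) dY for all x, y. THIS route is the ENGINE thesis of card
riccati-cluster-ghost-plasma
(γ(x,y)/ρ = Z[two half-charge ghosts at x,y]/Z[one unit charge] in the classical shadow e^(−2S) =
|Ψ₀|², S = −log Ψ₀): X is
not an item here but is DERIVED INSIDE the deciding theorem, by excluded middle on (∃M ∀r, v r ≤ M),
from (a) the engine on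
BOUNDED v — the Palm-mean increment of S (the KL node TeleportEntropyBound, stmt-9158 of
BECRieszShadow) splits, via the
canonical Hoeffding (uniform-measure) pair projection of S, into a PAIR part — a sup/L¹ split of the
renormalised pair kernel
(PairKernelSplit, rank 4) charged through integrable PINNED CLUSTERING of |Ψ₀|² around a tagged
particle
(PinnedShadowClustering, rank 3, 'perfect screening of the tagged charge') — and a BEYOND-PAIR part
of bounded Palm mean
(BeyondPairGhostWork, rank 2, the card's crux P), the typed junction being the low-rank crux
EngineToAffinity (rank 7:
PairKernelSplit → PinnedShadowClustering → BeyondPairGhostWork → X on bounded v; KL bookkeeping,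
then Palm–Jensen) — and
(b) HardCoreAffinity (crux, rank 8: X for UNBOUNDED v — hard cores, no KL currency). The frame is
two per-potential bridges:
AffinityToPeriodicBEC (crux, rank 5: an affinity-bounded nonnegative near-minimiser for every δ ⇒
macroscopic constant-mode
occupation of ALL near-minimisers, PeriodicBEC(v); foreseen via PeriodicRigidity 9467 +
PalmAffinityFlatMode 9163 +
PeriodicOccupationStability 9164) and BoundaryTransferWeak (crux, rank 6: PeriodicBEC(v) ⇒ Dirichlet
ground-state BEC at all
small ρ). ENGINE-ROOTED DECIDING THEOREM (2026-08-16 rev 16, D-0027 §2.1 + the cone rule): `closes`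
binds exactly the seven
cruxes — the three engine cruxes, the junction, the hard-core regime and the two frame bridges — so
every crux lies in the
deciding theorem's cone (H21: in_cone = binder_used = all seven, engine cruxes glue_used through
EngineToAffinity, none unused)
and no support, target or assembly item is a hypothesis.
Lean: `∀ v : ℝ → ENNReal,
Literature.MathematicalPhysics.QuantumManyBody.BoseGas.IsRepulsiveFiniteRange v → ∃ ρ₀ : ℝ, 0 < ρ₀ ∧
∀ ρ : ℝ, 0 < ρ → ρ < ρ₀ → ∃ C : ℝ, ∀ᶠ n : ℕ in Filter.atTop, ∀ δ : ENNReal, 0 < δ → ∃ Ψ :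
Literature.MathematicalPhysics.QuantumManyBody.BoseGas.PeriodicTrialState (n + 1)
(Literature.MathematicalPhysics.QuantumManyBody.BoseGas.sideLength ρ (n + 1)),
Literature.MathematicalPhysics.QuantumManyBody.BoseGas.periodicEnergy v Ψ ≤
Literature.MathematicalPhysics.QuantumManyBody.BoseGas.periodicGroundStateEnergy v (n + 1)
(Literature.MathematicalPhysics.QuantumManyBody.BoseGas.sideLength ρ (n + 1)) + δ ∧ (∀ X, Ψ.ψ X =
(‖Ψ.ψ X‖ : ℂ)) ∧ ∀ x y : Literature.MathematicalPhysics.QuantumManyBody.BoseGas.Space, ∫⁻ Y in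
Literature.MathematicalPhysics.QuantumManyBody.BoseGas.cellN n
(Literature.MathematicalPhysics.QuantumManyBody.BoseGas.sideLength ρ (n + 1)), (‖Ψ.ψ (Matrix.vecCons
x Y)‖₊ : ENNReal) ^ 2 ≤ ENNReal.ofReal (Real.exp C) * ∫⁻ Y in
Literature.MathematicalPhysics.QuantumManyBody.BoseGas.cellN n
(Literature.MathematicalPhysics.QuantumManyBody.BoseGas.sideLength ρ (n + 1)), (‖Ψ.ψ (Matrix.vecCons
x Y)‖₊ : ENNReal) * (‖Ψ.ψ (Matrix.vecCons y Y)‖₊ : ENNReal)`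

## Assembly
Deciding theorem (glue.lean, crux-only, term mode): `theorem closes (hPK : PairKernelSplit) (hPS :
PinnedShadowClustering)
(hBP : BeyondPairGhostWork) (hEJ : EngineToAffinity) (hHC : HardCoreAffinity) (hAP :
AffinityToPeriodicBEC)
(hT : BoundaryTransferWeak) : _root_.BoseEinsteinCondensation := fun v hv => hT v hv (hAP v hv
((Classical.em (∃ M : NNReal,
∀ r, v r ≤ M)).elim (hEJ hPK hPS hBP v hv) (hHC v hv)))` — for an admissible v, excluded middle on
boundedness picks the
engine's conclusion `hEJ hPK hPS hBP v hv` (X at a bounded v) or `hHC v hv` (X at an unbounded v),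
AffinityToPeriodicBEC v
turns it into PeriodicBEC(v), and BoundaryTransferWeak v reads off ∃ρ₀ ∀ρ<ρ₀ HasGroundStateBEC v ρ,
i.e. the conjunct
`_root_.BoseEinsteinCondensation` (root abbrev of the Literature statement, concluded BY NAME).
Every binder is a crux and every
crux is a binder. History: rev 0–4 `closes` bound X and the frame supports (BECRieszShadow shape);
rev 5–11 (route-choice
split) bound the engine cruxes plus five junction/frame SUPPORTS — certified native but stamped
glue.non-crux-hypothesis;
rev 12–13 (crux-only re-rooting) bound BoundedAffinity, HardCoreAffinity, AffinityToPeriodicBEC,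
BoundaryTransferWeak with the
engine reaching BoundedAffinity through the support EngineGlue — admissible, but the three engine
cruxes sat OUTSIDE the cone
of `closes` (H21 glue.unused-crux: 'not part of this route's argument'); rev 16 (engine re-rooting)
restates BoundedAffinity
14695 1:1 as the junction crux EngineToAffinity (its body inlined as the conclusion), drops
EngineGlue 14696 and restates the
Assembly as the type of the new `closes`. Items 11: 7 cruxes (ranks 2 3 4 engine, 5 frame bridge, 6
boundary transfer,
7 junction, 8 regime) = the crux cap, 3 supports (PalmJensen, PalmAffinityFlatMode,
PeriodicOccupationStability), 1 assembly
(= the type of `closes`, provable as `assembly_holds := closes`); no target item.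

Rationale: WHY THIS LINE. Positivity makes γ(x,y)/ρ(x) = E_(P_x)[exp(−(S(y,Y) − S(x,Y)))] ≥ exp(−E_(P_x)[S(y,·)
− S(x,·)]) (Jensen under the Palm law
P_x of the other N−1 bosons; McMillan1965, Reatto1969, GirvinMacdonald1987: the 1-pdm is a
partition-function ratio
with two half-charge ghosts, and ODLRO = bounded excess free energy of splitting a unit charge =
screening), so BEC at
small ρa³ follows from a uniform bound on the MEAN GHOST WORK (= ½KL(P_x‖P_y), the KL node
TeleportEntropyBound — crux stmt-9158 of
BECRieszShadow, reached INSIDE the junction crux EngineToAffinity of this route, whose `closes`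
binds the engine cruxes since the 2026-08-16 engine re-rooting).
The card's engine for that bound is the Riccati cluster picture: HΨ₀ = E₀Ψ₀ ⇔ |∇S|² − ΔS = V − E₀, S
= Σu₂ + Σu₃ + …
with the pair level = zero-energy scattering core + phonon-renormalised tail b/r²
(ReattoChester1967; Feenberg1969 §3.3
(3.28)–(3.29); CampbellFeenberg1969; VakarchukYukhnovskii1979) and e^(−2S) read as a weakly coupled
plasma of 1/r²
charges (BrydgesFederbush1980, BrydgesMartin1999 for the constructive screening technology). Instead
of typing a
Banach space of kernels now (k ≥ 3 kernels radiate 1/r²-type far fields, Berdahl1974), the route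
types the engine's DELIVERABLES as robust statements about Ψ₀ alone, using Hoeffding1948's
canonical decomposition to define 'pair part' without any ansatz: (P) the beyond-pair Hoeffding
remainder of S has
bounded Palm-mean increment; (S) |Ψ₀|² clusters integrably, to all orders, around a tagged particle;
plus (F₂) the
Hoeffding pair kernel is (sup-small tail) + (ρL¹-small core). Imported areas: U-statistics/ANOVA
(probability),
Palm calculus of point processes, classical screening/cluster-expansion bookkeeping; what it does
that BECRieszShadow
does not: a typed, engine-specific decomposition of its informal PhononDressing into three
independently attackable
statements, two of them (P, S) meaningful structural facts about the dilute Bose ground state on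
their own.

RANKED CRUXES. #2 BeyondPairGhostWork (crux) — (card crux P, canonical form; bounded v, N = m+2 on
the torus of side L = (N/ρ)^(1/3)) ∃ρ₀ ∀ρ<ρ₀ ∃C ∀ᶠm: for every EXACT positive translation-invariant
periodic ground state Ψ = e^(−S) and all x, y: ∫Ψ(x,Y)² [ (S(y,Y) − S(x,Y)) − Σ_j (u_H(y,Y_j) −
u_H(x,Y_j)) ] dY ≤ C ∫Ψ(x,Y)² dY, where u_H(x,z) = L^(−3m) ∫_(cell^m) S(x,z,W) dW is the
uniform-measure (Hoeffding) pair projection of S — the Palm mean of the BEYOND-PAIR ghost work is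
bounded uniformly in N and separation (the k ≥ 3 content of the ghost plasma; v ≡ 0: 0 ≤ C).
[difficulty: open-problem] (why it might fail: the three-body kernel has infrared weight û₃ ∼ |k|⁻¹
with a direction-dependent k₃ → 0 limit (three-phonon vertex), so beyond-pair terms may carry
Palm-mean work growing like log L, or the UNIFORM projection may be the wrong renormalisation at
strong cores.) [Berdahl1974, CampbellFeenberg1969, Feenberg1969, Hoeffding1948, Reatto1969,
Literature.Barriers.AtomisticToContinuum.BogoliubovPerturbationInfraredNarrow]
#3 PinnedShadowClustering (crux) — (card crux S in first-moment form: perfect screening of the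
tagged charge; bounded v) ∃K ∃ρ₀ ∀ρ<ρ₀ ∀ᶠm ∃ an EXACT positive translation-invariant periodic ground
state Ψ of N = m+2 bosons and a one-body envelope θ ≤ K with ρ∫_cell θ ≤ K such that for every
family of nonnegative test kernels g_k and all x, y: E_x[Σ_(B⊆bath) g_|B|(Y_B)] ≤ E_y[same] + Σ_k
K^k ρ^k Σ_(i<k) ∫_(cell^k) g_k(Z)(θ(x−Z_i) + θ(y−Z_i)) dZ, E_x = L³∫Ψ(x,Y)²(·)dY the Palm
expectation — the Palm laws at x and y differ, at every order k, only through integrable pinned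
truncated correlations (|ρ_x^(k) − ρ_y^(k)| ≲ k!K^kρ^kΣ_i θ); the item also carries existence of the
C¹ positive minimiser (elliptic regularity). v ≡ 0: θ = 0. [difficulty: open-problem] (why it might
fail: needs Ruelle-type bounds ρ^(k) ≤ (Kρ)^k and k!K^k tree growth for pinned truncated functions
of a Bose ground state, unproved; phonon tails h ∼ r⁻⁴ are integrable but a pinned three-point tail
∼ R⁻³ would give ρ∫θ ∼ log L.) [BrydgesFederbush1980, BrydgesMartin1999, Feenberg1969,
GhoshLebowitz2017, ReedSimonIV1978, PeilenSerfaty2025]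
#4 PairKernelSplit (crux) — (card crux F at pair level, canonical: 'scattering core +
phonon-renormalised tail') for bounded v and every ε > 0: ∃ρ₀ ∀ρ<ρ₀ ∀ᶠm, for every exact positive
translation-invariant ground state Ψ = e^(−S) of N = m+2 bosons the Hoeffding pair kernel splits as
u_H(x,z) = c + p(x−z) + w(x−z) with p, w continuous, sup|p| ≤ ε (long-range tail, expected b/(r²)
beyond r_c with b = π^(−3/2)(a/ρ)^(1/2)) and ρ∫_cell |w| ≤ ε (core, ρ(a r_c² + b r_c) → 0). v ≡ 0: p
= w = 0. [difficulty: L] (why it might fail: the uniform projection adds tadpoles ρ∫u₃(x,z,w)dw of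
the three-body kernel to the bare pair kernel; if û₃(k,−k,k₃) is singular as k₃ → 0 the tail of u_H
is not sup-small uniformly in L (only its |Ψ₀|²-weighted analogue would be).) [ReattoChester1967,
Feenberg1969, Berdahl1974, LSSY2005, Hoeffding1948]
#5 AffinityToPeriodicBEC (crux; NEW 2026-08-16, binder of `closes`) — per-potential FRAME BRIDGE
replacing, as hypothesis of the deciding theorem, BECRieszShadow's chain PeriodicRigidity (9467) →
PalmAffinityFlatMode (9163) → PeriodicOccupationStability (9164) → AffinityFrameGlue (9165)
(supports may not be hypotheses of `closes`): for each admissible v, the body of X at v (an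
affinity-bounded nonnegative δ-near-minimiser for every δ, eventually in N, at all small ρ) implies
PeriodicBEC(v) (∃ρ₀ ∀ρ<ρ₀ ∃c>0 ∀ᶠN ∃δ>0: EVERY δ-near-minimiser has condensateOccupation ≥ cN —
verbatim the hypothesis of BoundaryTransferWeak at v). Foreseen proof: flat-mode occupation ≥
e^(−C)N of the witness, transferred to all δ-near-minimisers by PeriodicRigidity (uniqueness + gap
at fixed N, η := e^(−C)/4 before N) and occupation stability, c := e^(−C)/4; the ENNReal bookkeeping
exists sorry-free (refuter g41-21 on stmt-9165). [difficulty: M] (why it might fail: the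
witness-to-all transfer needs fixed-N uniqueness + gap; ⊤-walls (hard cores, impenetrable shells)
can disconnect the torus configuration space and degenerate the ground state, so near-minimisers on
a jammed component need not inherit the witness's ODLRO.) [ReedSimonIV1978, LSSY2005, Fournais2020,
BaryshnikovBubenikKahle2013, PenroseOnsager1956]
#6 BoundaryTransferWeak (crux) — (shared verbatim, stmt-AtomisticToContinuum-0827) for each
repulsive finite-range v, PeriodicBEC(v) (constant-mode occupation ≥ cN for δ-near-minimisers of the
periodic energy at all small ρ) implies ∃ρ₀>0 ∀ρ∈(0,ρ₀) HasGroundStateBEC v ρ (Dirichlet,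
mode-free). [difficulty: L] (why it might fail: PeriodicBEC(v) is ground-state-only (δ after N): the
Dirichlet ground state lies a wall term ≫ δ above E₀^per and interior restrictions are neither
periodic nor of sharp N, so the hypothesis may never fire; only the ENERGY transfer is in print.)
[LiebSeiringerSolovejYngvason2005, Basti2022, BoccatoSeiringer2023, Junge2026, Robinson1976]
#7 EngineToAffinity (crux; NEW 2026-08-16 rev 16, binder of `closes`; restated 1:1 from the former
parent node BoundedAffinity stmt-14695 and replacing the support EngineGlue stmt-14696) — the
ghost-plasma engine's TYPED JUNCTION: PairKernelSplit → PinnedShadowClustering → BeyondPairGhostWork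
→ (X for BOUNDED admissible v: ∃ρ₀ ∀ρ<ρ₀ ∃C ∀ᶠ(N = n+1) ∀δ>0 ∃ a nonnegative periodic
δ-near-minimiser Ψ with ∫Ψ(x,Y)² dY ≤ e^C ∫Ψ(x,Y)Ψ(y,Y) dY for all x, y). Plan, two routine steps:
(1) KL step — Ψ := the S-witness (exact positive translation-invariant ground state ⇒
δ-near-minimiser for every δ), slice mass x-independent by translation + periodicity, KL(P_x‖P_y) =
2E_x[S_y − S_x]; pair part = (E_x − E_y)[Σ_j f(y − Y_j)], f = p + w from F₂ (translation invariance
turns 'two functions, one Palm law' into 'one function, two Palm laws'), charged through S's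
one-body test family applied to f⁺ at (x,y) and to f⁻ at (y,x) (sup p ≤ 1 against ρ∫θ ≤ K, ρ∫|w| ≤ 1
against θ ≤ K): ≤ 8K²; beyond-pair part ≤ C_P by P; C_T := 2(C_P + 8K²); (2) Jensen step —
PalmJensen with ψ := re∘Ψ.ψ, K := C_T, Bochner → lintegral on the bounded cell, C := C_T/2. A
low-rank crux, not a support, because only cruxes or PROVED lemmas may feed `closes` (D-0027 §2.1)
and the junction is unproved; once a standalone Theorems lemma over the PeriodicBoseGas vocabulary
proves it, `closes` discharges it in-term. v ≡ 0: C = 0. [deps: PalmJensen] [difficulty: M] (why it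
might fail: routine but unproved, corrected twice already (g44-13): the pair charge needs both
envelope bounds of S one-sidedly at (x,y) and (y,x); a Bochner/lintegral normalisation or finiteness
mismatch between P, F₂ and S would leave it unprovable as typed — continuity is automatic,
PeriodicTrialState being C¹.) [Hoeffding1948, Reatto1969, McMillan1965, PenroseOnsager1956]
#8 HardCoreAffinity (crux) — (binder of `closes`; SHARED by signature with
stmt-AtomisticToContinuum-10241 HardCorePalmAffinity of BECLiebAntibunching (grounded,
refuter-checked) and with BECRieszShadow) the body of X = PalmAffinityBound for every admissible v
that is NOT bounded (¬∃M ∀r, v r ≤ M: hard cores v = ⊤ on [0,a], impenetrable shells ⊤·1_[r₁,r₂],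
finite but unbounded repulsive cores): ∃ρ₀ ∀ρ<ρ₀ ∃C ∀ᶠ(N = n+1) ∀δ>0 ∃ a nonnegative periodic
δ-near-minimiser Ψ with ∫Ψ(x,Y)² dY ≤ e^C ∫Ψ(x,Y)Ψ(y,Y) dY for all x, y — the complementary regime
of the KL engine (TeleportEntropyBound is typed for bounded v because KL(P_x‖P_y) = +∞ once Ψ
vanishes on a core); foreseen mechanism: event-conditioned Jensen A(x,y) ≥ P_x(y
uncovered)·exp(−E_x[S(y,·) − S(x,·) | y uncovered]) with P_x(y covered) = O(ρa³) (cavity probability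
of the hard-sphere shadow), or (a, R₀)-uniform constants of the bounded chain under truncation v∧M ↑
v; numerics: hard-sphere DMC condensate fraction → 1 − (8/(3√π))√(ρa³)
(GiorginiBoronatCasulleras1999). Rank 8: regime-completion debt shared with every Palm/KL line,
below the ghost-plasma engine this thesis is about; with EngineToAffinity it reassembles X by
excluded middle inside `closes`. [difficulty: open-problem] (why it might fail: it is the target on
⊤-cores with no KL: needs P_x(y uncovered) ≥ c > 0 and bounded CONDITIONAL ghost work uniformly in
|x−y| ≤ L√3/2 and N — unproved cavity screening; caging shells ⊤·1_[r₁,r₂] are admissible and may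
jam near-minimisers.) [LSSY2005, LiebSeiringer2002, KalosLevesqueVerlet1974,
GiorginiBoronatCasulleras1999, Reatto1969, McMillan1965, Dyson1957]
#9 PalmJensen (support) — (shared verbatim, stmt-AtomisticToContinuum-9162) for a continuous
strictly positive ψ on (n+1)-configurations with x-independent slice mass Z: if ∫ψ(x,Y)²
log(ψ(x,Y)²/ψ(y,Y)²) dY ≤ K·Z for all x, y then e^(−K/2) Z ≤ ∫ψ(x,Y)ψ(y,Y) dY (Jensen for exp under
the Palm law) — the lemma consumed by step (2) of EngineToAffinity (KL bound → X on bounded v, C ↦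
C_T/2). [difficulty: provable-now] [Reatto1969, McMillan1965, PenroseOnsager1956]
#9 PalmAffinityFlatMode (support) — (shared verbatim, stmt-AtomisticToContinuum-9163) for L > 0 and
a nonnegative periodic trial state Ψ of n+1 bosons with ∫|Ψ(x,Y)|² dY ≤ e^C ∫|Ψ(x,Y)||Ψ(y,Y)| dY for
all x, y: condensateOccupation ≥ e^(−C)(n+1) (Fubini through the cell indicators) — ingredient of
the foreseen proof of AffinityToPeriodicBEC. [difficulty: provable-now] [PenroseOnsager1956,
LSSY2005, Fournais2020]
#9 PeriodicOccupationStability (support) — (shared verbatim, stmt-AtomisticToContinuum-9164)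
condensateOccupation(Ψ)^(1/2) ≤ condensateOccupation(Φ)^(1/2) + N^(1/2)(∫_(cell^N)|Ψ − cΦ|²)^(1/2)
for periodic trial states and |c| = 1 (Minkowski) — ingredient of the foreseen proof of
AffinityToPeriodicBEC. [difficulty: provable-now] [LSSY2005, Fournais2020]
#1 Assembly (assembly; restated 2026-08-16 rev 16; the shared stmt-10446 stays BECRieszShadow's) —
PairKernelSplit → PinnedShadowClustering → BeyondPairGhostWork → EngineToAffinity → HardCoreAffinity
→ AffinityToPeriodicBEC → BoundaryTransferWeak → BoseEinsteinCondensation = the type of `closes`;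
`assembly_holds := closes`. [difficulty: provable-now]

TWO-LAYER PLAN. (0) ENGINE-ROOTED `closes` (2026-08-16 rev 16; the rev-12/13 shape left the three
engine cruxes OUTSIDE the cone of `closes` — glue.unused-crux — since they reached the binder
BoundedAffinity only through the unproved support EngineGlue): `closes` binds the seven cruxes; X at
a bounded v is the in-term value `hEJ hPK hPS hBP v hv`, at an unbounded v `hHC v hv`; X,
TeleportEntropyBound, PeriodicRigidity, AffinityFrameGlue, Assembly 10446 stay BECRieszShadow's; no
new route.
(i) Layer 2 under HardCoreAffinity (foreseen, NOT filed; k ≤ 3): UncoveredMass (P_x(y uncovered) ≥ 1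
− Kρa³ for near-minimisers) → ConditionalGhostWork (E_x[S(y,·) − S(x,·) | y uncovered] ≤ C) →
HardCoreAffinity (event-conditioned Jensen), or SoftCoreUniformity ((a, R₀)-uniform constants of the
bounded chain) → truncation v∧M ↑ v; shared with BECRieszShadow's plan.
(ii) BeyondPairGhostWork ⇐ RiccatiClusterFixedPoint → KernelTailScreening → BeyondPairGhostWork: F =
−log Ψ₀ as a fixed point of the many-body Riccati equation in a MULTISCALE norm (each Hoeffding
component split per variable into a pointwise-small harmonic/phonon far field and an L¹-small near
field; neutral kernels), S-proper = the far fields' Palm-mean increments are screened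
(Debye/Brydges–Federbush bookkeeping for the û ∼ 1/|k| class); glue = Hölder pairing of near fields
with PinnedShadowClustering.
(iii) PinnedShadowClustering ⇐ GroundStateRegularity (existence of the C¹ positive
translation-invariant minimiser, W^(2,p) elliptic regularity) → RuelleBound (ρ^(k) ≤ (Kρ)^k for
|Ψ₀|²) → PinnedClusteringProper.
(iv) AffinityToPeriodicBEC ⇐ PeriodicRigidity (9467) + PalmAffinityFlatMode +
PeriodicOccupationStability + the AffinityFrameGlue bookkeeping — items of BECRieszShadow /
BECLiebAntibunching, staffed there; a prover of #5 cites their `_holds`; not re-filed here (crux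
cap).

KILL CRITERIA. ¬X on the BOUNDED class (a bounded admissible v whose nonnegative near-minimisers all
violate the affinity bound at arbitrarily small ρ; it lands as ¬PalmAffinityBound in BECRieszShadow)
makes EngineToAffinity ∧ ranks 2–4 jointly untenable: identify the false conjunct (junction
bookkeeping vs P, S, F₂) for the negatives index and close `refuted:<it>`. ¬EngineToAffinity AS
TYPED (a Bochner/lintegral normalisation gap) ⇒ misstated ⇒ repaired junction EngineToAffinityR +
the same `closes` over it. ¬BeyondPairGhostWork with PinnedShadowClustering intact ⇒ the uniform
(Hoeffding) projection is the wrong renormalisation: ONE pivot allowed — restate P and F with the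
|Ψ₀|²-weighted (potential-of-mean-force) pair projection E_(|Ψ₀|²)[S | x, z], whose tail is the
screened r⁻⁴ one, and EngineToAffinity with them; if that is refuted too the first-moment ghost
plasma is dead: close `refuted:BeyondPairGhostWork`. ¬PinnedShadowClustering (non-integrable pinned
clustering of the true Born law at some order) kills the screening dictionary outright: close.
¬PairKernelSplit alone ⇒ same pivot as for P. ¬TeleportEntropyBound landed in BECRieszShadow (KL
unbounded while the affinity may stay bounded: Jensen loss) means one of ranks 2–4 is false by step
(1) of EngineToAffinity: close `refuted:<that crux>` or `superseded` by whichever exponential-moment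
route survives. ¬HardCoreAffinity (a ⊤-core or unbounded-core admissible v whose nonnegative
near-minimisers all violate the affinity bound at arbitrarily small ρ) closes this route AND
BECRieszShadow `refuted:HardCoreAffinity` unless the witness is a caging shell ⊤·1_[r₁,r₂] (then
misstated ⇒ repaired item HardCoreAffinityR excluding jammed components + the same `closes` over
it). ¬AffinityToPeriodicBEC: witness v with ⊤-walls disconnecting the torus configuration space ⇒
misstated ⇒ repaired bridge AffinityToPeriodicBECR on the dilute component + new `closes`; witness a
BOUNDED v ⇒ the witness-to-all frame is dead for every Palm line: pivot once to a witness-free frame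
(affinity bound for ALL near-minimisers) or close `refuted:AffinityToPeriodicBEC`. X proved
elsewhere (BECRieszShadow) moots the engine but not the frame (then re-root `closes` on X or close
`superseded`); HardCoreAffinity proved elsewhere moots only the hard-core regime; PeriodicRigidity +
the three frame supports proved in BECRieszShadow close #5 by bookkeeping.

NOT DECOMPOSED YET. The Banach space / multiscale norms of the Riccati fixed point and the abstract
kernel-class screening theorem (plan (ii)) — deliberately
NOT typed: naive mixed norms (sup over a pinned pair, L¹ in the rest) are FALSE for the true
kernels, whose k ≥ 3 components radiate
1/r²-type far fields (Berdahl1974, Feenberg1969 App. 5-C), and an abstract class theorem needs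
stability/envelope hypotheses that only
the F-provers can fix; the INSIDE of HardCoreAffinity (cavity probability + conditional ghost work,
or soft-to-hard uniformity: plan (i)); the inside of AffinityToPeriodicBEC beyond plan (iv) (a
rigidity-free transfer); the Dirichlet-direct variant (inner box, one-body wall kernel,
FederbushKennedy1985-type surface screening); exponential-moment (beyond-Jensen) versions giving
n₀/ρ = 1 − O(√(ρa³)); T > 0.
Constants: only C < ∞ / c > 0 are asked.

CHEAPEST FALSIFIER. (i) Hand sanity (done): every typed item holds for v ≡ 0 with Ψ ≡ L^(−3N/2) (S
constant: P with C = 0, S-crux with θ = 0 and K = 1,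
F₂ with p = w = 0; EngineToAffinity with C = 0; AffinityToPeriodicBEC by the free torus gap (2π/L)²
at fixed N with δ chosen after N; degenerate m, x = y, g = ⊤ cases checked: both Palm sides charge
equally since Ψ > 0). (i′) Logic (Sketch.lean rc 0, H21 closes OK with all seven cruxes in cone): X
at v = EngineToAffinity's conclusion (v bounded) or HardCoreAffinity's (v unbounded) by excluded
middle inside `closes`; EngineToAffinity = GhostWorkGlue ∘ PalmJensen; AffinityToPeriodicBEC ∧ X ⇒
AffinityFrameGlue's conclusion. (ii) d = 1 consistency: the
analogous statements for the Lieb–Liniger/Tonks gas are false (pair kernel ∼ log r, KL ∼ log L) —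
the items are ℝ³-specific through
integrability of θ and the sup-smallness of the tail, as the barrier OneDimensionalHardCore demands.
(iii) Lookup run: Berdahl1974 / CampbellFeenberg1969 / Feenberg1969 App. 5-C — û₃ has a finite
direction-dependent limit as one momentum → 0 (tadpoles finite, real-space tail ∼ R⁻⁵ jointly),
consistent with P and F₂ but not proving them. (iv) Not run (hub compute-free): VMC on N = 64…512
soft spheres at ρa³ = 10⁻³: E_x[Δ − Δ_pair] (P) and ρ∫|h| + pinned 3-point mass (S) versus L; a log
L drift retires the corresponding crux.

NUMBERS. Units ħ = 2m = 1. Bogoliubov: E_p = √(p⁴ + 16πρa p²), c_s = 4√(πρa), S(p) = p²/E_p; healing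
= screening length ξ = (8πρa)^(−1/2);
renormalised pair tail u₂(r) → b/r², b = π^(−3/2)(a/ρ)^(1/2) (Feenberg1969 (3.28): u_LRC =
(mc/π²ρħ)(r² + k_c⁻²)⁻¹ for ψ²);
classical pair symbol 2û₂(p) → c_s/(ρ|p|)·2; coupling at mean spacing bρ^(2/3) =
π^(−3/2)(ρa³)^(1/6); particles per screening
volume ρξ³ = (8π)^(−3/2)(ρa³)^(−1/2); F₂ split scale r_c = (b/ε)^(1/2);
correlation hole ρ∫h = −1 + S(0) = −1 exactly at fixed N (so K ≥ 1 in S); expected condensate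
fraction 1 − (8/(3√π))√(ρa³)
(LSSY2005 App. A), i.e. C ≈ (4/√π)√(ρa³) in PalmAffinityBound. Items: 13 at open, 15 after the badge
repair / route-choice split, 12 after the crux-only re-rooting, 11 after the 2026-08-16 engine
re-rooting (7 cruxes = cap, all binders of `closes`; 3 supports; 1 assembly = type of `closes`; no
target): further nodes only by `--split` or after a `--drop`.

DEFINITION REQUESTS. None filed. The notion the engine proper needs (plan (ii):
`ManyBodyKernelNorms` — Hoeffding components of −log Ψ₀ with a per-variable far-field/near-field
split and neutral kernels) is research-level design, not a standard notion Lean lacks (tenure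
planner). Literature facts the layer-2 engine would consume as hypotheses: BrydgesFederbush1980
(Debye screening), Imbrie1983 (jellium), FederbushKennedy1985 (half-space) — cite items when (ii) is
typed.

Novelty: Searches (2026-08-15, this planner; gen-1 planner's 16 crossref + 4 galaxy queries and refuter
audits AUDIT-1/14/16/29/32 adopted):
`lit frontier AtomisticToContinuum --since 2022` (30 rows: arXiv:2510.20493, arXiv:2603.20776,
arXiv:2602.16566, arXiv:2605.06844 — energy /
localisation lines, none on positivity or Palm structure); `lit search --source crossref` ×2
("Jastrow three-body correlations Bose
condensate fraction": 10 noise; "optimal three-body correlations Bose liquid ground state long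
wavelength": Berdahl1974
doi:10.1103/physreva.10.2378, Yamasaki–Hirooka 1981 doi:10.1143/ptp.66.1200, Szybisz 1990/93); `lit
vsearch` ("lower bound on the 1-pdm of a
positive ground state via relative entropy of conditional laws": textbooks only); `lit galaxy search
--star all` ×3 ("three-body
correlations ground state Bose condensate fraction Jastrow": 0; "triplet correlations in the ground
state": 0; "three-phonon vertex": 9,
incl. Feenberg1969 = panama:184666413858821, read §3.3–3.4 and §6/App. 5-C); local searchd down (rc
75), OpenAlex 429, arXiv API 0.
Nearest prior art found: GirvinMacdonald1987 (1-pdm = Z[two half-charges]/Z, screening decides ODLRO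
— for Laughlin states);
Reatto1969 / McMillan1965 / Chester1970 (classical-analogy condensate fraction for PAIR-product
states); VakarchukYukhnovskii1979,
VakarchukYukhnovskii1980 (log Ψ₀ = Σ u_n from the first-quantised Riccati/collective-variable
equations, non-rigorous);
CampbellFeenberg1969 + Feenberg1969 (paired-phonon analysis  [refs: 10.1103/physreva.10.2378, 10.1143/ptp.66.1200, 2510.20493, 2603.20776, 2602.16566, 2605.06844, doi:10.1103/physreva.10.2378, doi:10.1143/ptp.66.1200, Berdahl1974, Feenberg1969, GirvinMacdonald1987, Reatto1969, McMillan1965, Chester1970, VakarchukYukhnovskii1979, VakarchukYukhnovskii1980, CampbellFeenberg1969, BrydgesFederbush1980, Hoeffding1948]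

Barriers (technique_class: riccati-cluster, classical-screening, psi0-positive, palm-KL): - technique_class: riccati-cluster, classical-screening, psi0-positive, palm-KL
- Literature.Barriers.AtomisticToContinuum.BogoliubovPerturbationInfrared: bears on
BeyondPairGhostWork and PairKernelSplit only through the STATIC three-body kernel (three-phonon
vertex, û₃ ∼ |k|⁻¹): equal-time, gauge-invariant configuration-space objects of a positive function;
the catalogued divergent object (the frequency bubble ∫G_c², momentum-independent vertices) never
appears — honest bet that the Palm mean of the beyond-pair remainder is L-uniform in d = 3 (kill
signal: log L).
- Literature.Barriers.AtomisticToContinuum.BogoliubovPerturbationInfraredNarrow: by its own list the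
infrared inputs used here (S(k), u₂ tail, static kernels) are the non-divergent ones; no expansion
is used in the typed items at all.
- Literature.Barriers.AtomisticToContinuum.KineticGapLengthScales: outside its class — no energy
window (the items speak of the EXACT ground state: positivity, the eigenvalue equation pointwise),
no box gap converted into depletion; the frame's only window is δ below the fixed-(N,L) gap inside
PeriodicRigidity.
- Literature.Barriers.AtomisticToContinuum.EnergyAsymptoticsWithoutCondensation: evaded — the
currency is the wave function (Palm laws of |Ψ₀|²), not E₀/N.
- Literature.Barriers.AtomisticToContinuum.KineticGapLengthScalesNarrow: outside its class by its
own list — the engine items use the TRUE ground state beyond the value of its energy (exact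
minimiser, positivity Ψ₀ > 0, the

History (route lifecycle, newest last):
- 2026-08-16T03:44:32Z · AUTO-CRUX (backfill): PalmAffinityBound — hypotheses of the deciding theorem that nothing in the route derives are cruxes (operator:999:586464)
- 2026-08-16T06:03:37Z · rev 12: restated Assembly (stmt-AtomisticToContinuum-10446) — crux-only re-rooting (route-repair g2, D-0027 §2.1), STEP 1/2 — make room under the caps (the gate cap-checks add_items before drops: 'would be 9 cruxes / 18 it (planner-rbadge-AtomisticToContinuum-BECRiccati-b83521a9-g2-0)
- 2026-08-16T06:03:37Z · rev 12: dropped PalmAffinityBound, TeleportEntropyBound, PeriodicRigidity, GhostWorkGlue, AffinityGlue, AffinityFrameGlue — crux-only re-rooting (route-repair g2, D-0027 §2.1), STEP 1/2 — make room under the caps (the gate cap-checks add_items before drops: 'would be 9 cruxes / 18 it (planner-rbadge-AtomisticToContinuum-BECRiccati-b83521a9-g2-0)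
- 2026-08-16T06:07:55Z · rev 13: restated Assembly (stmt-AtomisticToContinuum-14690) — route-repair g2 (crux-only deciding theorem, D-0027 §2.1; clears glue.non-crux-hypothesis + the phantom crux-cap), STEP 2/2: `closes` re-rooted on CRUX binders (planner-rbadge-AtomisticToContinuum-BECRiccati-b83521a9-g2-0)
- 2026-08-16T08:34:03Z · rev 16: restated BoundedAffinity (stmt-AtomisticToContinuum-14695), Assembly (stmt-AtomisticToContinuum-14693) — engine re-rooting (route-repair g3, D-0027 §2.1 cone rule; H21 glue.unused-crux on the rev-13 shape: the three ENGINE cruxes BeyondPairGhostWork, PinnedShadowCl (planner-rbadge-AtomisticToContinuum-BECRiccati-b83521a9-g3-0)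
- 2026-08-16T08:34:03Z · rev 16: dropped EngineGlue — engine re-rooting (route-repair g3, D-0027 §2.1 cone rule; H21 glue.unused-crux on the rev-13 shape: the three ENGINE cruxes BeyondPairGhostWork, PinnedShadowCl (planner-rbadge-AtomisticToContinuum-BECRiccati-b83521a9-g3-0)
- 2026-08-25T01:52:10Z · DORMANT — reconciler: no traction for 7.3 d (last activity item-evidence-added at 2026-08-17T18:55:01Z); parked, not closed — `ledger route dormant route-AtomisticToConti (operator:999:765166)
- 2026-08-29T03:27:20Z · REACTIVATED — reconciler: reactivated — activity statement-checked at 2026-08-29T01:17:37Z after parking at 2026-08-25T01:52:10Z (operator:999:195607)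

sub-problem: BoseEinsteinCondensation · status: open · opened planner-plancard-AtomisticToContinuum-BoseEin-abfb0aaf-g2-0 2026-08-15T19:18:03Z · rev 18 · ledger route-AtomisticToContinuum-BECRiccatiGhostPlasma
GENERATED by the gate from the ledger (D-0016/17). Provers cite these decls: `theorem foo : Summit.AtomisticToContinuum.BoseEinsteinCondensation.Theses.BECRiccatiGhostPlasma.<Decl> := …` in Summits/AtomisticToContinuum/BoseEinsteinCondensation/Theorems/<Name>.lean.
-/

namespace Summit.AtomisticToContinuum.BoseEinsteinCondensation.Theses.BECRiccatiGhostPlasma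

open scoped BigOperators Topology Manifold Classical MeasureTheory ProbabilityTheory Matrix InnerProductSpace ComplexConjugate ContinuousMap
open Filter Set Function TopologicalSpace MeasureTheory

attribute [summit_statement] _root_.BoseEinsteinCondensation

/-- item stmt-AtomisticToContinuum-13505 · crux · rank 2 · open · by planner
why it might fail: the three-body kernel has infrared weight û₃ ∼ |k|⁻¹ with a direction-dependent k₃ → 0 limit (three-phonon vertex), so beyond-pair terms may carry Palm-mean work growing like log L, or the UNIFORM projection may be the wrong renormalisation at strong cores.
sources: Berdahl1974, CampbellFeenberg1969, Feenberg1969, Hoeffding1948, Reatto1969, Literature.Barriers.AtomisticToContinuum.BogoliubovPerturbationInfraredNarrow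
[crux] (card crux P, canonical form; bounded v, N = m+2 on the torus of side L = (N/ρ)^(1/3)) ∃ρ₀
∀ρ<ρ₀ ∃C ∀ᶠm: for every EXACT positive translation-invariant periodic ground state Ψ = e^(−S) and
all x, y: ∫Ψ(x,Y)² [ (S(y,Y) − S(x,Y)) − Σ_j (u_H(y,Y_j) − u_H(x,Y_j)) ] dY ≤ C ∫Ψ(x,Y)² dY, where
u_H(x,z) = L^(−3m) ∫_(cell^m) S(x,z,W) dW is the uniform-measure (Hoeffding) pair projection of S —
the Palm mean of the BEYOND-PAIR ghost work is bounded uniformly in N and separation (the k ≥ 3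
content of the ghost plasma; v ≡ 0: 0 ≤ C). [difficulty: open-problem] -/
@[route_item "route-AtomisticToContinuum-BECRiccatiGhostPlasma", crux]
def BeyondPairGhostWork : Prop :=
  ∀ v : ℝ → ENNReal, Literature.MathematicalPhysics.QuantumManyBody.BoseGas.IsRepulsiveFiniteRange v → (∃ M : NNReal, ∀ r, v r ≤ M) → ∃ ρ₀ : ℝ, 0 < ρ₀ ∧ ∀ ρ : ℝ, 0 < ρ → ρ < ρ₀ → ∃ C : ℝ, ∀ᶠ m : ℕ in Filter.atTop, ∀ Ψ : Literature.MathematicalPhysics.QuantumManyBody.BoseGas.PeriodicTrialState (m + 2) (Literature.MathematicalPhysics.QuantumManyBody.BoseGas.sideLength ρ (m + 2)), Literature.MathematicalPhysics.QuantumManyBody.BoseGas.periodicEnergy v Ψ = Literature.MathematicalPhysics.QuantumManyBody.BoseGas.periodicGroundStateEnergy v (m + 2) (Literature.MathematicalPhysics.QuantumManyBody.BoseGas.sideLength ρ (m + 2)) → (∀ X, 0 < (Ψ.ψ X).re ∧ (Ψ.ψ X).im = 0) → (∀ (a : Literature.MathematicalPhysics.QuantumManyBody.BoseGas.Space) (X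 : Literature.MathematicalPhysics.QuantumManyBody.BoseGas.Config (m + 2)), Ψ.ψ (fun i => X i + a) = Ψ.ψ X) → ∀ x y : Literature.MathematicalPhysics.QuantumManyBody.BoseGas.Space, (∫ Y in Literature.MathematicalPhysics.QuantumManyBody.BoseGas.cellN (m + 1) (Literature.MathematicalPhysics.QuantumManyBody.BoseGas.sideLength ρ (m + 2)), (Ψ.ψ (Matrix.vecCons x Y)).re ^ 2 * ((Real.log ((Ψ.ψ (Matrix.vecCons x Y)).re) - Real.log ((Ψ.ψ (Matrix.vecCons y Y)).re)) - ∑ j : Fin (m + 1), ((ρ / ((m : ℝ) + 2)) ^ m * (∫ W in Literature.MathematicalPhysics.QuantumManyBody.BoseGas.cellN m (Literature.MathematicalPhysics.QuantumManyBody.BoseGas.sideLength ρ (m + 2)), -Real.log ((Ψ.ψ (Matrix.vecCons y (Matrix.vecCons (Y j) W))).re)) - (ρ / ((m : ℝ) + 2)) ^ m * (∫ W in Literature.MathematicalPhysics.QuantumManyBody.BoseGas.cellN m (Literature.MathematicalPhysics.QuantumManyBody.BoseGas.sideLength ρ (m + 2)), -Real.log ((Ψ.ψ (Matrix.vecCons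 x (Matrix.vecCons (Y j) W))).re))))) ≤ C * ∫ Y in Literature.MathematicalPhysics.QuantumManyBody.BoseGas.cellN (m + 1) (Literature.MathematicalPhysics.QuantumManyBody.BoseGas.sideLength ρ (m + 2)), (Ψ.ψ (Matrix.vecCons x Y)).re ^ 2

/-- item stmt-AtomisticToContinuum-13506 · crux · rank 3 · open · by planner
why it might fail: needs Ruelle-type bounds ρ^(k) ≤ (Kρ)^k and k!K^k tree growth for pinned truncated functions of a Bose ground state, unproved; phonon tails h ∼ r⁻⁴ are integrable but a pinned three-point tail ∼ R⁻³ would give ρ∫θ ∼ log L.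
sources: BrydgesFederbush1980, BrydgesMartin1999, Feenberg1969, GhoshLebowitz2017, ReedSimonIV1978, PeilenSerfaty2025
[crux] (card crux S in first-moment form: perfect screening of the tagged charge; bounded v) ∃K ∃ρ₀
∀ρ<ρ₀ ∀ᶠm ∃ an EXACT positive translation-invariant periodic ground state Ψ of N = m+2 bosons and a
one-body envelope θ ≤ K with ρ∫_cell θ ≤ K such that for every family of nonnegative test kernels
g_k and all x, y: E_x[Σ_(B⊆bath) g_|B|(Y_B)] ≤ E_y[same] + Σ_k K^k ρ^k Σ_(i<k) ∫_(cell^k)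
g_k(Z)(θ(x−Z_i) + θ(y−Z_i)) dZ, E_x = L³∫Ψ(x,Y)²(·)dY the Palm expectation — the Palm laws at x and
y differ, at every order k, only through integrable pinned truncated correlations (|ρ_x^(k) −
ρ_y^(k)| ≲ k!K^kρ^kΣ_i θ); the item also carries existence of the C¹ positive minimiser (elliptic
regularity). v ≡ 0: θ = 0. [difficulty: open-problem] -/
@[route_item "route-AtomisticToContinuum-BECRiccatiGhostPlasma", crux]
def PinnedShadowClustering : Prop :=
  ∀ v : ℝ → ENNReal, Literature.MathematicalPhysics.QuantumManyBody.BoseGas.IsRepulsiveFiniteRange v → (∃ M : NNReal, ∀ r, v r ≤ M) → ∃ K : ℝ, 0 < K ∧ ∃ ρ₀ : ℝ, 0 < ρ₀ ∧ ∀ ρ : ℝ, 0 < ρ → ρ < ρ₀ → ∀ᶠ m : ℕ in Filter.atTop, ∃ Ψ : Literature.MathematicalPhysics.QuantumManyBody.BoseGas.PeriodicTrialState (m + 2) (Literature.MathematicalPhysics.QuantumManyBody.BoseGas.sideLength ρ (m + 2)), Literature.MathematicalPhysics.QuantumManyBody.BoseGas.periodicEnergy v Ψ = Literature.MathematicalPhysics.QuantumManyBody.BoseGas.periodicGroundStateEnergy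 v (m + 2) (Literature.MathematicalPhysics.QuantumManyBody.BoseGas.sideLength ρ (m + 2)) ∧ (∀ X, 0 < (Ψ.ψ X).re ∧ (Ψ.ψ X).im = 0) ∧ (∀ (a : Literature.MathematicalPhysics.QuantumManyBody.BoseGas.Space) (X : Literature.MathematicalPhysics.QuantumManyBody.BoseGas.Config (m + 2)), Ψ.ψ (fun i => X i + a) = Ψ.ψ X) ∧ ∃ θ : Literature.MathematicalPhysics.QuantumManyBody.BoseGas.Space → ENNReal, Measurable θ ∧ (∀ z, θ z ≤ ENNReal.ofReal K) ∧ ENNReal.ofReal ρ * (∫⁻ z in Literature.MathematicalPhysics.QuantumManyBody.BoseGas.cell (Literature.MathematicalPhysics.QuantumManyBody.BoseGas.sideLength ρ (m + 2)), θ z) ≤ ENNReal.ofReal K ∧ ∀ g : (k : ℕ) → Literature.MathematicalPhysics.QuantumManyBody.BoseGas.Config k → ENNReal, (∀ k, Measurable (g k)) → ∀ x y : Literature.MathematicalPhysics.QuantumManyBody.BoseGas.Space, ENNReal.ofReal (((m : ℝ) + 2) / ρ) * (∫⁻ Y in Literature.MathematicalPhysics.QuantumManyBody.BoseGas.cellN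 (m + 1) (Literature.MathematicalPhysics.QuantumManyBody.BoseGas.sideLength ρ (m + 2)), (‖Ψ.ψ (Matrix.vecCons x Y)‖₊ : ENNReal) ^ 2 * (∑ B : Finset (Fin (m + 1)), g B.card (fun i => Y (B.orderEmbOfFin rfl i)))) ≤ ENNReal.ofReal (((m : ℝ) + 2) / ρ) * (∫⁻ Y in Literature.MathematicalPhysics.QuantumManyBody.BoseGas.cellN (m + 1) (Literature.MathematicalPhysics.QuantumManyBody.BoseGas.sideLength ρ (m + 2)), (‖Ψ.ψ (Matrix.vecCons y Y)‖₊ : ENNReal) ^ 2 * (∑ B : Finset (Fin (m + 1)), g B.card (fun i => Y (B.orderEmbOfFin rfl i)))) + ∑ k ∈ Finset.range (m + 2), ENNReal.ofReal (K ^ k * ρ ^ k) * ∑ i : Fin k, (∫⁻ Z in Literature.MathematicalPhysics.QuantumManyBody.BoseGas.cellN k (Literature.MathematicalPhysics.QuantumManyBody.BoseGas.sideLength ρ (m + 2)), g k Z * (θ (x - Z i) + θ (y - Z i)))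

/-- item stmt-AtomisticToContinuum-13507 · crux · rank 4 · open · by planner
why it might fail: the uniform projection adds tadpoles ρ∫u₃(x,z,w)dw of the three-body kernel to the bare pair kernel; if û₃(k,−k,k₃) is singular as k₃ → 0 the tail of u_H is not sup-small uniformly in L (only its |Ψ₀|²-weighted analogue would be).
sources: ReattoChester1967, Feenberg1969, Berdahl1974, LSSY2005, Hoeffding1948
[crux] (card crux F at pair level, canonical: 'scattering core + phonon-renormalised tail') for
bounded v and every ε > 0: ∃ρ₀ ∀ρ<ρ₀ ∀ᶠm, for every exact positive translation-invariant ground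
state Ψ = e^(−S) of N = m+2 bosons the Hoeffding pair kernel splits as u_H(x,z) = c + p(x−z) +
w(x−z) with p, w continuous, sup|p| ≤ ε (long-range tail, expected b/(r²) beyond r_c with b =
π^(−3/2)(a/ρ)^(1/2)) and ρ∫_cell |w| ≤ ε (core, ρ(a r_c² + b r_c) → 0). v ≡ 0: p = w = 0.
[difficulty: L] -/
@[route_item "route-AtomisticToContinuum-BECRiccatiGhostPlasma", crux]
def PairKernelSplit : Prop :=
  ∀ v : ℝ → ENNReal, Literature.MathematicalPhysics.QuantumManyBody.BoseGas.IsRepulsiveFiniteRange v → (∃ M : NNReal, ∀ r, v r ≤ M) → ∀ ε : ℝ, 0 < ε → ∃ ρ₀ : ℝ, 0 < ρ₀ ∧ ∀ ρ : ℝ, 0 < ρ → ρ < ρ₀ → ∀ᶠ m : ℕ in Filter.atTop, ∀ Ψ : Literature.MathematicalPhysics.QuantumManyBody.BoseGas.PeriodicTrialState (m + 2) (Literature.MathematicalPhysics.QuantumManyBody.BoseGas.sideLength ρ (m + 2)), Literature.MathematicalPhysics.QuantumManyBody.BoseGas.periodicEnergy v Ψ = Literature.MathematicalPhysics.QuantumManyBody.BoseGas.periodicGroundStateEnergy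 v (m + 2) (Literature.MathematicalPhysics.QuantumManyBody.BoseGas.sideLength ρ (m + 2)) → (∀ X, 0 < (Ψ.ψ X).re ∧ (Ψ.ψ X).im = 0) → (∀ (a : Literature.MathematicalPhysics.QuantumManyBody.BoseGas.Space) (X : Literature.MathematicalPhysics.QuantumManyBody.BoseGas.Config (m + 2)), Ψ.ψ (fun i => X i + a) = Ψ.ψ X) → ∃ (c : ℝ) (p w : Literature.MathematicalPhysics.QuantumManyBody.BoseGas.Space → ℝ), Continuous p ∧ Continuous w ∧ (∀ z, |p z| ≤ ε) ∧ ρ * (∫ z in Literature.MathematicalPhysics.QuantumManyBody.BoseGas.cell (Literature.MathematicalPhysics.QuantumManyBody.BoseGas.sideLength ρ (m + 2)), |w z|) ≤ ε ∧ ∀ x z : Literature.MathematicalPhysics.QuantumManyBody.BoseGas.Space, (ρ / ((m : ℝ) + 2)) ^ m * (∫ W in Literature.MathematicalPhysics.QuantumManyBody.BoseGas.cellN m (Literature.MathematicalPhysics.QuantumManyBody.BoseGas.sideLength ρ (m + 2)), -Real.log ((Ψ.ψ (Matrix.vecCons x (Matrix.vecCons z W))).re)) = c + p (x - z) + w (x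 - z)

/-- item stmt-AtomisticToContinuum-14694 · crux · rank 5 · open · by planner
why it might fail: The witness-to-all transfer needs fixed-N uniqueness + gap (rigidity); ⊤-walls (hard cores, impenetrable shells ⊤·1_[r₁,r₂]) can disconnect the torus configuration space and degenerate the ground state, so near-minimisers on a jammed component need not inherit the witness's ODLRO.
sources: ReedSimonIV1978, LSSY2005, Fournais2020, BaryshnikovBubenikKahle2013, PenroseOnsager1956
[crux] AFFINITY ⇒ PERIODIC BEC, per potential (frame bridge; replaces, as binder of the crux-only
`closes`, the chain PeriodicRigidity stmt-9467 → PalmAffinityFlatMode 9163 →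
PeriodicOccupationStability 9164 → AffinityFrameGlue 9165 of BECRieszShadow, since supports may not
be hypotheses of a deciding theorem): for each admissible v, IF at all small ρ there are C and,
eventually in N = n+1, for every δ > 0 a nonnegative periodic δ-near-minimiser with ∫Ψ(x,Y)² ≤
e^C∫Ψ(x,Y)Ψ(y,Y) for all x, y (the body of X at v), THEN PeriodicBEC(v): ∃ρ₀ ∀ρ<ρ₀ ∃c>0 ∀ᶠN ∃δ>0
such that EVERY δ-near-minimiser of the periodic energy has condensateOccupation ≥ cN (verbatim the
hypothesis of BoundaryTransferWeak at v). Foreseen proof (all ingredients are items staffed in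
BECRieszShadow / BECLiebAntibunching): the witness has constant-mode occupation ≥ e^(−C)N
(PalmAffinityFlatMode: Fubini through the cell indicators); PeriodicRigidity (unique positive ground
state + spectral gap at fixed N ⇒ any two δ-near-minimisers are η-close in L²(cell^N) up to a phase,
η := e^(−C)/4 fixed before N) and PeriodicOccupationStability (Minkowski: occ^(1/2) is √N-Lipschitz
in L²) transfer it to every δ-near-minimiser with -/
@[route_item "route-AtomisticToContinuum-BECRiccatiGhostPlasma", crux]
def AffinityToPeriodicBEC : Prop :=
  ∀ v : ℝ → ENNReal, Literature.MathematicalPhysics.QuantumManyBody.BoseGas.IsRepulsiveFiniteRange v → (∃ ρ₀ : ℝ, 0 < ρ₀ ∧ ∀ ρ : ℝ, 0 < ρ → ρ < ρ₀ → ∃ C : ℝ, ∀ᶠ n : ℕ in Filter.atTop, ∀ δ : ENNReal, 0 < δ → ∃ Ψ : Literature.MathematicalPhysics.QuantumManyBody.BoseGas.PeriodicTrialState (n + 1) (Literature.MathematicalPhysics.QuantumManyBody.BoseGas.sideLength ρ (n + 1)), Literature.MathematicalPhysics.QuantumManyBody.BoseGas.periodicEnergy v Ψ ≤ Literature.MathematicalPhysics.QuantumManyBody.BoseGas.periodicGroundStateEnergy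 v (n + 1) (Literature.MathematicalPhysics.QuantumManyBody.BoseGas.sideLength ρ (n + 1)) + δ ∧ (∀ X, Ψ.ψ X = (‖Ψ.ψ X‖ : ℂ)) ∧ ∀ x y : Literature.MathematicalPhysics.QuantumManyBody.BoseGas.Space, ∫⁻ Y in Literature.MathematicalPhysics.QuantumManyBody.BoseGas.cellN n (Literature.MathematicalPhysics.QuantumManyBody.BoseGas.sideLength ρ (n + 1)), (‖Ψ.ψ (Matrix.vecCons x Y)‖₊ : ENNReal) ^ 2 ≤ ENNReal.ofReal (Real.exp C) * ∫⁻ Y in Literature.MathematicalPhysics.QuantumManyBody.BoseGas.cellN n (Literature.MathematicalPhysics.QuantumManyBody.BoseGas.sideLength ρ (n + 1)), (‖Ψ.ψ (Matrix.vecCons x Y)‖₊ : ENNReal) * (‖Ψ.ψ (Matrix.vecCons y Y)‖₊ : ENNReal)) → ∃ ρ₀ : ℝ, 0 < ρ₀ ∧ ∀ ρ : ℝ, 0 < ρ → ρ < ρ₀ → ∃ c : ℝ, 0 < c ∧ ∀ᶠ N : ℕ in Filter.atTop, ∃ δ : ENNReal, 0 < δ ∧ ∀ Ψ : Literature.MathematicalPhysics.QuantumManyBody.BoseGas.PeriodicTrialState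 N (Literature.MathematicalPhysics.QuantumManyBody.BoseGas.sideLength ρ N), Literature.MathematicalPhysics.QuantumManyBody.BoseGas.periodicEnergy v Ψ ≤ Literature.MathematicalPhysics.QuantumManyBody.BoseGas.periodicGroundStateEnergy v N (Literature.MathematicalPhysics.QuantumManyBody.BoseGas.sideLength ρ N) + δ → ENNReal.ofReal (c * N) ≤ Literature.MathematicalPhysics.QuantumManyBody.BoseGas.condensateOccupation N (Literature.MathematicalPhysics.QuantumManyBody.BoseGas.sideLength ρ N) Ψ.ψ

/-- item stmt-AtomisticToContinuum-0827 · crux · rank 6 · open · by planner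
why it might fail: PeriodicBEC(v) is ground-state-only (δ after N): the Dirichlet ground state lies a wall term ≫ δ above E₀^per and interior restrictions are neither periodic nor of sharp N, so the hypothesis may never fire; only the ENERGY transfer is in print.
sources: LiebSeiringerSolovejYngvason2005, Basti2022, BoccatoSeiringer2023, Junge2026, Robinson1976
[crux] BoundaryTransferWeak (mode-free boundary-condition transfer, per potential): for each
repulsive finite-range v, PeriodicBEC(v) implies ∃ρ₀>0 ∀ρ∈(0,ρ₀) HasGroundStateBEC v ρ (Dirichlet
ground state, λ_max(γ) ≥ cN via condensateNumber). Not glue: near-minimiser slacks are O(N/L²) while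
Dirichlet/periodic energies differ by a boundary term ≫ N/L², so no energy-comparison proof;
expected route: Neumann bracketing of interior sub-boxes (−Δ_Dir ≥ ⊕−Δ_Neu, v ≥ 0) + a mode-free
criterion (λ_max ≥ tr γ²/N). Only the ENERGY analogue is in print (LiebSeiringerSolovejYngvason2005
Ch. 2 after (2.8)). v ≡ 0: hypothesis and conclusion both true. -/
@[route_item "route-AtomisticToContinuum-BECRiccatiGhostPlasma", crux]
def BoundaryTransferWeak : Prop :=
  ∀ v : ℝ → ENNReal, Literature.MathematicalPhysics.QuantumManyBody.BoseGas.IsRepulsiveFiniteRange v → (∃ ρ₀ : ℝ, 0 < ρ₀ ∧ ∀ ρ : ℝ, 0 < ρ → ρ < ρ₀ → ∃ c : ℝ, 0 < c ∧ ∀ᶠ N : ℕ in Filter.atTop, ∃ δ : ENNReal, 0 < δ ∧ ∀ Ψ : Literature.MathematicalPhysics.QuantumManyBody.BoseGas.PeriodicTrialState N (Literature.MathematicalPhysics.QuantumManyBody.BoseGas.sideLength ρ N), Literature.MathematicalPhysics.QuantumManyBody.BoseGas.periodicEnergy v Ψ ≤ Literature.MathematicalPhysics.QuantumManyBody.BoseGas.periodicGroundStateEnergy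 v N (Literature.MathematicalPhysics.QuantumManyBody.BoseGas.sideLength ρ N) + δ → ENNReal.ofReal (c * N) ≤ Literature.MathematicalPhysics.QuantumManyBody.BoseGas.condensateOccupation N (Literature.MathematicalPhysics.QuantumManyBody.BoseGas.sideLength ρ N) Ψ.ψ) → ∃ ρ₀ : ℝ, 0 < ρ₀ ∧ ∀ ρ : ℝ, 0 < ρ → ρ < ρ₀ → Literature.MathematicalPhysics.QuantumManyBody.BoseGas.HasGroundStateBEC v ρ

/-- item stmt-AtomisticToContinuum-15142 · crux · rank 7 · open · by planner
why it might fail: Routine but unproved, corrected twice (g44-13): the pair charge needs both envelope bounds of S (θ ≤ K for the L¹-core w, ρ∫θ ≤ K for the sup-tail p) one-sidedly at (x,y) and (y,x); a Bochner/lintegral normalisation or finiteness mismatch between P, F₂ and S would leave it unprovable as typed.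
sources: Hoeffding1948, Reatto1969, McMillan1965, PenroseOnsager1956, Fournais2020
[crux] ENGINE ⇒ BOUNDED-v AFFINITY — the ghost-plasma engine's TYPED JUNCTION and a binder of the
crux-only `closes` (2026-08-16 rev 16 engine re-rooting: restated 1:1 from the former parent node
BoundedAffinity stmt-14695, whose body it inlines as its conclusion, and replacing the support
EngineGlue stmt-14696, so that the three engine cruxes lie IN the deciding theorem's cone):
PairKernelSplit → PinnedShadowClustering → BeyondPairGhostWork → for every BOUNDED admissible v, ∃ρ₀
∀ρ<ρ₀ ∃C ∀ᶠ(N = n+1) ∀δ>0 ∃ a nonnegative periodic δ-near-minimiser Ψ (L = (N/ρ)^(1/3)) with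
∫Ψ(x,Y)² dY ≤ e^C ∫Ψ(x,Y)Ψ(y,Y) dY for all x, y (the body of X = PalmAffinityBound, stmt-9157 of
BECRieszShadow, on the bounded class; with HardCoreAffinity it reassembles X by excluded middle
inside `closes`). Proof plan, two routine steps (the KL step was re-derived sound by refuter g44-13
with two corrections): (1) KL step — fix bounded v; K, ρ₀ˢ from PinnedShadowClustering, ε := 1 in
PairKernelSplit, ρ₀ := min of the three, eventually in m (intersection of the three atTop sets), n
:= m+1; for every δ take Ψ := the S-witness (exact positive translation-invariant ground state ⇒
δ-near-minimiser; 0 < re Ψ, im Ψ = 0 -/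
@[route_item "route-AtomisticToContinuum-BECRiccatiGhostPlasma", crux]
def EngineToAffinity : Prop :=
  PairKernelSplit → PinnedShadowClustering → BeyondPairGhostWork → ∀ v : ℝ → ENNReal, Literature.MathematicalPhysics.QuantumManyBody.BoseGas.IsRepulsiveFiniteRange v → (∃ M : NNReal, ∀ r, v r ≤ M) → ∃ ρ₀ : ℝ, 0 < ρ₀ ∧ ∀ ρ : ℝ, 0 < ρ → ρ < ρ₀ → ∃ C : ℝ, ∀ᶠ n : ℕ in Filter.atTop, ∀ δ : ENNReal, 0 < δ → ∃ Ψ : Literature.MathematicalPhysics.QuantumManyBody.BoseGas.PeriodicTrialState (n + 1) (Literature.MathematicalPhysics.QuantumManyBody.BoseGas.sideLength ρ (n + 1)), Literature.MathematicalPhysics.QuantumManyBody.BoseGas.periodicEnergy v Ψ ≤ Literature.MathematicalPhysics.QuantumManyBody.BoseGas.periodicGroundStateEnergy v (n + 1) (Literature.MathematicalPhysics.QuantumManyBody.BoseGas.sideLength ρ (n + 1)) + δ ∧ (∀ X, Ψ.ψ X = (‖Ψ.ψ X‖ : ℂ)) ∧ ∀ x y : Literature.MathematicalPhysics.QuantumManyBody.BoseGas.Space,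 ∫⁻ Y in Literature.MathematicalPhysics.QuantumManyBody.BoseGas.cellN n (Literature.MathematicalPhysics.QuantumManyBody.BoseGas.sideLength ρ (n + 1)), (‖Ψ.ψ (Matrix.vecCons x Y)‖₊ : ENNReal) ^ 2 ≤ ENNReal.ofReal (Real.exp C) * ∫⁻ Y in Literature.MathematicalPhysics.QuantumManyBody.BoseGas.cellN n (Literature.MathematicalPhysics.QuantumManyBody.BoseGas.sideLength ρ (n + 1)), (‖Ψ.ψ (Matrix.vecCons x Y)‖₊ : ENNReal) * (‖Ψ.ψ (Matrix.vecCons y Y)‖₊ : ENNReal)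

/-- item stmt-AtomisticToContinuum-10241 · crux · rank 8 · open · by planner
why it might fail: It is the target on ⊤-cores with no KL: needs P_x(y uncovered) ≥ c > 0 and bounded CONDITIONAL ghost work uniformly in |x−y| ≤ L√3/2 and N (unproved cavity screening); caging shells ⊤·1_[r₁,r₂] are admissible and may jam near-minimisers.
sources: LSSY2005, LiebSeiringer2002, KalosLevesqueVerlet1974, GiorginiBoronatCasulleras1999, Reatto1969, McMillan1965
[crux] HARD-CORE PALM AFFINITY: the body of PalmAffinityBound for the members of the class that are
NOT bounded (v taking the value ⊤ or unbounded finite values: hard spheres, hard core plus tail).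
Filed as a crux because the positivity engine above is typed on exact C¹ ground states, which do not
exist for hard cores (Ψ₀ is Lipschitz at contact): the ∃-witness must be a C¹ near-minimiser
approximating Ψ₀, with the event-conditioned Jensen γ(x,y)/ρ ≥ P_x(A_y)·exp(−E[Δ | A_y]), P_x(A_y) ≥
1 − (4π/3)ρa³ sup g₂ (anti-bunching of the approximant supplies the void bound). [deps:
AntibunchingGS, NonPairwisePalmMean] [difficulty: open-problem] -/
@[route_item "route-AtomisticToContinuum-BECRiccatiGhostPlasma", crux]
def HardCoreAffinity : Prop :=
  ∀ v : ℝ → ENNReal, Literature.MathematicalPhysics.QuantumManyBody.BoseGas.IsRepulsiveFiniteRange v → (¬ ∃ M : NNReal, ∀ r, v r ≤ M) → ∃ ρ₀ : ℝ, 0 < ρ₀ ∧ ∀ ρ : ℝ, 0 < ρ → ρ < ρ₀ → ∃ C : ℝ, ∀ᶠ n : ℕ in Filter.atTop, ∀ δ : ENNReal, 0 < δ → ∃ Ψ : Literature.MathematicalPhysics.QuantumManyBody.BoseGas.PeriodicTrialState (n + 1) (Literature.MathematicalPhysics.QuantumManyBody.BoseGas.sideLength ρ (n + 1)), Literature.MathematicalPhysics.QuantumManyBody.BoseGas.periodicEnergy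 v Ψ ≤ Literature.MathematicalPhysics.QuantumManyBody.BoseGas.periodicGroundStateEnergy v (n + 1) (Literature.MathematicalPhysics.QuantumManyBody.BoseGas.sideLength ρ (n + 1)) + δ ∧ (∀ X, Ψ.ψ X = (‖Ψ.ψ X‖ : ℂ)) ∧ ∀ x y : Literature.MathematicalPhysics.QuantumManyBody.BoseGas.Space, ∫⁻ Y in Literature.MathematicalPhysics.QuantumManyBody.BoseGas.cellN n (Literature.MathematicalPhysics.QuantumManyBody.BoseGas.sideLength ρ (n + 1)), (‖Ψ.ψ (Matrix.vecCons x Y)‖₊ : ENNReal) ^ 2 ≤ ENNReal.ofReal (Real.exp C) * ∫⁻ Y in Literature.MathematicalPhysics.QuantumManyBody.BoseGas.cellN n (Literature.MathematicalPhysics.QuantumManyBody.BoseGas.sideLength ρ (n + 1)), (‖Ψ.ψ (Matrix.vecCons x Y)‖₊ : ENNReal) * (‖Ψ.ψ (Matrix.vecCons y Y)‖₊ : ENNReal)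

/-- item stmt-AtomisticToContinuum-9162 · support · rank 9 · open · by planner
sources: Reatto1969, McMillan1965, PenroseOnsager1956
[support] PALM–JENSEN. For a continuous strictly positive ψ on (n+1)-configurations with
x-independent slice mass Z = ∫_(cell^n) ψ(x,Y)² dY: if ∫ψ(x,Y)² log(ψ(x,Y)²/ψ(y,Y)²) dY ≤ K·Z for
all x, y then e^(−K/2) Z ≤ ∫ψ(x,Y)ψ(y,Y) dY (Jensen for exp under p_x = ψ(x,·)²/Z: E[√(p_y/p_x)] ≥
exp(−½KL(p_x‖p_y))). [difficulty: provable-now] -/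
@[route_item "route-AtomisticToContinuum-BECRiccatiGhostPlasma"]
def PalmJensen : Prop :=
  ∀ (n : ℕ) (L K : ℝ) (ψ : Literature.MathematicalPhysics.QuantumManyBody.BoseGas.Config (n + 1) → ℝ), 0 < L → Continuous ψ → (∀ X, 0 < ψ X) → (∀ x y : Literature.MathematicalPhysics.QuantumManyBody.BoseGas.Space, ∫ Y in Literature.MathematicalPhysics.QuantumManyBody.BoseGas.cellN n L, ψ (Matrix.vecCons x Y) ^ 2 = ∫ Y in Literature.MathematicalPhysics.QuantumManyBody.BoseGas.cellN n L, ψ (Matrix.vecCons y Y) ^ 2) → (∀ x y : Literature.MathematicalPhysics.QuantumManyBody.BoseGas.Space, ∫ Y in Literature.MathematicalPhysics.QuantumManyBody.BoseGas.cellN n L, ψ (Matrix.vecCons x Y) ^ 2 * Real.log (ψ (Matrix.vecCons x Y) ^ 2 / ψ (Matrix.vecCons y Y) ^ 2) ≤ K * ∫ Y in Literature.MathematicalPhysics.QuantumManyBody.BoseGas.cellN n L, ψ (Matrix.vecCons x Y) ^ 2) → ∀ x y : Literature.MathematicalPhysics.QuantumManyBody.BoseGas.Space, Real.exp (-(K /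 2)) * ∫ Y in Literature.MathematicalPhysics.QuantumManyBody.BoseGas.cellN n L, ψ (Matrix.vecCons x Y) ^ 2 ≤ ∫ Y in Literature.MathematicalPhysics.QuantumManyBody.BoseGas.cellN n L, ψ (Matrix.vecCons x Y) * ψ (Matrix.vecCons y Y)

/-- item stmt-AtomisticToContinuum-9163 · support · rank 9 · open · by planner
sources: PenroseOnsager1956, LSSY2005, Fournais2020
[support] AFFINITY ⇒ FLAT MODE. For L > 0 and a nonnegative periodic trial state Ψ of n+1 bosons
with ∫|Ψ(x,Y)|² dY ≤ e^C ∫|Ψ(x,Y)||Ψ(y,Y)| dY for all x, y: condensateOccupation ≥ e^(−C)(n+1) (n₀ =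
(n+1)L⁻³∫_cell∫_cell∫_(cell^n) Ψ(x,Y)Ψ(y,Y); Fubini for x::Y through the cell indicators of
condensateOccupation; ∫_cell∫_(cell^n)|Ψ(x,Y)|² = 1). [difficulty: provable-now] -/
@[route_item "route-AtomisticToContinuum-BECRiccatiGhostPlasma"]
def PalmAffinityFlatMode : Prop :=
  ∀ (n : ℕ) (L C : ℝ), 0 < L → ∀ Ψ : Literature.MathematicalPhysics.QuantumManyBody.BoseGas.PeriodicTrialState (n + 1) L, (∀ X, Ψ.ψ X = (‖Ψ.ψ X‖ : ℂ)) → (∀ x y : Literature.MathematicalPhysics.QuantumManyBody.BoseGas.Space, ∫⁻ Y in Literature.MathematicalPhysics.QuantumManyBody.BoseGas.cellN n L, (‖Ψ.ψ (Matrix.vecCons x Y)‖₊ : ENNReal) ^ 2 ≤ ENNReal.ofReal (Real.exp C) * ∫⁻ Y in Literature.MathematicalPhysics.QuantumManyBody.BoseGas.cellN n L, (‖Ψ.ψ (Matrix.vecCons x Y)‖₊ : ENNReal) * (‖Ψ.ψ (Matrix.vecCons y Y)‖₊ : ENNReal)) → ENNReal.ofReal (Real.exp (-C) * (n + 1)) ≤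 Literature.MathematicalPhysics.QuantumManyBody.BoseGas.condensateOccupation (n + 1) L Ψ.ψ

/-- item stmt-AtomisticToContinuum-9164 · support · rank 9 · closed · proved by Summit.AtomisticToContinuum.BoseEinsteinCondensation.Theorems.periodicOccupationStability_proof (prover) · by planner
sources: LSSY2005, Fournais2020
[support] OCCUPATION STABILITY on the torus: for periodic trial states Ψ, Φ of N bosons and |c| = 1,
condensateOccupation(Ψ)^(1/2) ≤ condensateOccupation(Φ)^(1/2) + N^(1/2) (∫_(cell^N)|Ψ − cΦ|²)^(1/2)
(F_Ψ(Y) = ⟨φ₀, Ψ(·,Y)1_cell⟩, |F_Ψ − F_(cΦ)| ≤ ‖(Ψ − cΦ)(·,Y)‖_(L²(cell)), Minkowski in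
L²(cell^(N−1)); occ(cΦ) = occ(Φ)). [difficulty: provable-now] -/
@[route_item "route-AtomisticToContinuum-BECRiccatiGhostPlasma"]
def PeriodicOccupationStability : Prop :=
  ∀ (N : ℕ) (L : ℝ), 0 < L → ∀ (Ψ Φ : Literature.MathematicalPhysics.QuantumManyBody.BoseGas.PeriodicTrialState N L) (c : ℂ), ‖c‖ = 1 → Literature.MathematicalPhysics.QuantumManyBody.BoseGas.condensateOccupation N L Ψ.ψ ^ (1 / 2 : ℝ) ≤ Literature.MathematicalPhysics.QuantumManyBody.BoseGas.condensateOccupation N L Φ.ψ ^ (1 / 2 : ℝ) + (N : ENNReal) ^ (1 / 2 : ℝ) * (∫⁻ X in Literature.MathematicalPhysics.QuantumManyBody.BoseGas.cellN N L, (‖Ψ.ψ X - c * Φ.ψ X‖₊ : ENNReal) ^ 2) ^ (1 / 2 : ℝ)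

/-- `PeriodicOccupationStability` holds: proved by `Summit.AtomisticToContinuum.BoseEinsteinCondensation.Theorems.periodicOccupationStability_proof`. -/
theorem PeriodicOccupationStability_holds : PeriodicOccupationStability := _root_.Summit.AtomisticToContinuum.BoseEinsteinCondensation.Theorems.periodicOccupationStability_proof

-- earlier Assembly (stmt-AtomisticToContinuum-10446, replaced 2026-08-16T06:03:37Z -> stmt-AtomisticToContinuum-14690): open — PalmAffinityBound → PeriodicRigidity → PalmAffinityFlatMode → PeriodicOccupationStability → AffinityFrameGlue → BoundaryTransferWeak → _root_.BoseEinsteinCondensation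
-- earlier Assembly (stmt-AtomisticToContinuum-14690, replaced 2026-08-16T06:07:55Z -> stmt-AtomisticToContinuum-14693): retired by None — BeyondPairGhostWork → PinnedShadowClustering → PairKernelSplit → HardCoreAffinity → BoundaryTransferWeak → _root_.BoseEinsteinCondensation
-- earlier Assembly (stmt-AtomisticToContinuum-14693, replaced 2026-08-16T08:34:03Z -> stmt-AtomisticToContinuum-15143): retired by None — BoundedAffinity → HardCoreAffinity → AffinityToPeriodicBEC → BoundaryTransferWeak → _root_.BoseEinsteinCondensation
/-- item stmt-AtomisticToContinuum-15143 · assembly · rank 1 · open · by planner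
sources: LSSY2005, PenroseOnsager1956
[assembly] PairKernelSplit → PinnedShadowClustering → BeyondPairGhostWork → EngineToAffinity →
HardCoreAffinity → AffinityToPeriodicBEC → BoundaryTransferWeak → BoseEinsteinCondensation (the
sub-problem Statement decl `_root_.BoseEinsteinCondensation`, by name) — literally the type of the
ENGINE-ROOTED crux-only DECIDING THEOREM `closes` (2026-08-16 rev 16); term: `fun hPK hPS hBP hEJ
hHC hAP hT v hv => hT v hv (hAP v hv ((Classical.em (∃ M : NNReal, ∀ r, v r ≤ M)).elim (hEJ hPK hPS
hBP v hv) (hHC v hv)))`; a prover lands `theorem assembly_holds : Assembly := closes`. Restated from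
the rev-13 Assembly stmt-14693 (BoundedAffinity → HardCoreAffinity → AffinityToPeriodicBEC →
BoundaryTransferWeak → BoseEinsteinCondensation); the shared frame-level Assembly stmt-10446 stays
BECRieszShadow's. [difficulty: provable-now] -/
@[route_item "route-AtomisticToContinuum-BECRiccatiGhostPlasma"]
def Assembly : Prop :=
  PairKernelSplit → PinnedShadowClustering → BeyondPairGhostWork → EngineToAffinity → HardCoreAffinity → AffinityToPeriodicBEC → BoundaryTransferWeak → _root_.BoseEinsteinCondensation

-- records of items no longer active in this route (dropped / restated):
-- earlier AffinityGlue (stmt-AtomisticToContinuum-14197, replaced 2026-08-16T03:21:33Z -> stmt-AtomisticToContinuum-14389): retired by None — TeleportEntropyBound → PalmJensen → HardCoreAffinity → PalmAffinityBound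
-- earlier BoundedAffinity (stmt-AtomisticToContinuum-14695, replaced 2026-08-16T08:34:03Z -> stmt-AtomisticToContinuum-15142): retired by None — ∀ v : ℝ → ENNReal, Literature.MathematicalPhysics.QuantumManyBody.BoseGas.IsRepulsiveFiniteRange v → (∃ M : NNReal, ∀ r, v r ≤ M) → ∃ ρ₀ : ℝ, 0 < ρ₀ ∧ ∀ ρ : ℝ, 0 < ρ → ρ < ρ₀ → ∃ C : ℝ, ∀ᶠ n : ℕ in Filter.atTop, ∀ δ : ENNReal, 0 < δ → ∃ Ψ : Literature.Mathe

/-! D-0027 §2.1 — DECIDING THEOREM (planner-authored via `route open/edit --closes-file`; by planner-rbadge-AtomisticToContinuum-BECRiccati-b83521a9-g3-0 2026-08-16T08:34:03Z):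
its hypotheses are this route's items and its conclusion the sub-problem Statement (glue_lint), and it elaborates with this file. -/

@[closes "route-AtomisticToContinuum-BECRiccatiGhostPlasma"] theorem closes (hPK : PairKernelSplit) (hPS : PinnedShadowClustering) (hBP : BeyondPairGhostWork)
    (hEJ : EngineToAffinity) (hHC : HardCoreAffinity) (hAP : AffinityToPeriodicBEC)
    (hT : BoundaryTransferWeak) : _root_.BoseEinsteinCondensation :=
  fun v hv => hT v hv (hAP v hv ((Classical.em (∃ M : NNReal, ∀ r, v r ≤ M)).elim (hEJ hPK hPS hBP v hv) (hHC v hv)))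

end Summit.AtomisticToContinuum.BoseEinsteinCondensation.Theses.BECRiccatiGhostPlasma
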